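import Mathlib
import Summits.Ventures.PercRepro2.OneEdge
import Summits.Ventures.PercRepro2.KPrimeReduction
import Summits.Ventures.PercRepro2.KPrimeSure
import Summits.Ventures.PercRepro2.KPrimeVBase
import Summits.Ventures.PercRepro2.KPrimePendantLemmas
import Summits.Ventures.PercRepro2.KPrimePendant

/-!
# The leaf martingale of the margin potential `M_T` of the `v`-exploration of `(K′)`
(blind cell PercRepro2, mine-c g34; `conjectures/MINE-C.md` §43.2)

Roots `a₁, a₂`, mark `b`, vertex `v`, vertex `y`; `Ω = {a₁ ↮ a₂}`, `S = {a₂ ↮ {a₁, v}}`, `U = {v ∈ C₁}`,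
`X = {b ∈ C₁}`, `W = {y ∈ C₁}`, `Y = {y ∈ C₂}`, the classes `(0,1)ᵉ`, `(0,1)` of `KPrimeReduction.lean`.
The MARGIN POTENTIAL of the lane is `M_T := Φ_K + κ · P(Ω) · T / P(S)` with `κ = Cov_Ω(X, U)` and `T`
the four-mark quantity of `MINE-C.md` §42.11; exactly (§43.2 (i))

  `P(S) · M_T = P_Ω(ū w S (Xe − E_Ω)) − P_Ω(U Y (X − E_Ω)) + P_Ω(U (X − E_Ω)) · ν_Ω(y ∈ C₁ ∪ C₂)`,

`E_Ω = P(X | Ω)` the unavoided lean, so that `mtForm := P(Ω)² · P(S) · M_T` is the polynomial in the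
masses below (no division), and `(K′-T)` — `(K′-Ω+)` of §42.5 weakened by the allowance
`κ · P(Ω) · (P(Y | Ω) − P(Y | S)) ≥ 0` — is `0 ≤ mtForm`.

**Theorem** (`mtForm_leaf`): if `v` is a LEAF whose only edge is `e = {v, z}` of weight `t`, then

  `mtForm(v-instance) = (1 − t) · P(Ω) · baseCov + t · mtForm(z-instance)`,

where the `z`-instance is the graph with `e` pinned closed and `z` in the role of `v`, and
`baseCov = P(Ω) P(b, y ∈ C₁, Ω) − P(y ∈ C₁, Ω) P(b ∈ C₁, Ω)` is the cleared base-case covariance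
(the isolated-`v` world, `≥ 0` by van den Berg–Kahn).  So `M_T` is an exact MIXTURE (a martingale) of
the leaf step: `M_T(p) = (1 − π) M_T(p[e↦0]) + π M_T(p[e↦1])`, `π = P_S(e open)`; in particular
`(K′-T)` is inherited along leaf attachments with no hypothesis (`kprimeT_of_leaf`).  The reason: in
the identity above the only product of world-dependent masses is `P_Ω(U(X − E_Ω)) · ν_Ω(y ∈ C₁ ∪ C₂)`,
and for a leaf `v` neither `E_Ω`, nor `ν_Ω(y ∈ C₁ ∪ C₂)`, nor `P(Ω)` sees `e`.
-/

namespace Summit.Ventures.PercRepro2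

namespace KPrime

variable {V : Type*} {E : Type*} [Fintype E] [DecidableEq E] [Fintype V] [DecidableEq V]
  {R : Type*} [Field R] [LinearOrder R] [IsStrictOrderedRing R]

section Defs

variable (ends : E → Sym2 V) (a₁ a₂ b v y : V) (p : E → R)

/-- The cleared margin potential `mtForm = P(Ω)² · P(S) · M_T`, `M_T = Φ_K + κ P(Ω) T / P(S)`:
`O² P((0,1)ᵉ) − O P(X∩Ω) P((0,1)) − O² P(U∩Y∩X∩Ω) + O P(X∩Ω) P(U∩Y∩Ω)
  + (O P(U∩X∩Ω) − P(X∩Ω) P(U∩Ω)) · (P(W∩Ω) + P(Y∩Ω))`, `O = P(Ω)`. -/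
noncomputable def mtForm : R :=
  prob p (Ω ends a₁ a₂) ^ 2 * prob p (cls01e ends a₁ a₂ b v y) -
    prob p (Ω ends a₁ a₂) * prob p (connEvent ends a₁ b ∩ Ω ends a₁ a₂) *
      prob p (cls01 ends a₁ a₂ v y) -
    prob p (Ω ends a₁ a₂) ^ 2 *
      prob p (connEvent ends a₁ v ∩ connEvent ends a₂ y ∩ connEvent ends a₁ b ∩ Ω ends a₁ a₂) +
    prob p (Ω ends a₁ a₂) * prob p (connEvent ends a₁ b ∩ Ω ends a₁ a₂) *
      prob p (connEvent ends a₁ v ∩ connEvent ends a₂ y ∩ Ω ends a₁ a₂) +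
    (prob p (Ω ends a₁ a₂) * prob p (connEvent ends a₁ v ∩ connEvent ends a₁ b ∩ Ω ends a₁ a₂) -
        prob p (connEvent ends a₁ b ∩ Ω ends a₁ a₂) * prob p (connEvent ends a₁ v ∩ Ω ends a₁ a₂)) *
      (prob p (connEvent ends a₁ y ∩ Ω ends a₁ a₂) + prob p (connEvent ends a₂ y ∩ Ω ends a₁ a₂))

/-- `(K′-T)` in cleared form: `0 ≤ mtForm`, i.e. `P(S) Φ_K + κ P(Ω) T ≥ 0`. -/
def KPrimeTHolds : Prop := 0 ≤ mtForm ends a₁ a₂ b v y p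

/-- The cleared base-case covariance `P(Ω) P(b, y ∈ C₁, Ω) − P(y ∈ C₁, Ω) P(b ∈ C₁, Ω)`
(`= P(Ω)² · Cov_Ω(y ∈ C₁, b ∈ C₁)`, the value of `P(Ω)² Φ_K` when `v` is isolated). -/
noncomputable def baseCov : R :=
  prob p (Ω ends a₁ a₂) * prob p (connEvent ends a₁ b ∩ connEvent ends a₁ y ∩ Ω ends a₁ a₂) -
    prob p (connEvent ends a₁ y ∩ Ω ends a₁ a₂) * prob p (connEvent ends a₁ b ∩ Ω ends a₁ a₂)

end Defs

section Leaf

variable {ends : E → Sym2 V} {a₁ a₂ b v y z : V} {p : E → R} {e : E}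

/-- The base-case covariance is non-negative (van den Berg–Kahn, one root given `a₁ ↮ a₂`). -/
lemma baseCov_nonneg (hp : IsProbVec p) : 0 ≤ baseCov ends a₁ a₂ b y p := by
  have hΩc := Ω_eq_compl (ends := ends) (a₁ := a₁) (a₂ := a₂)
  have vC := vdBK_pair p hp ends a₁ b y a₂
  rw [← hΩc] at vC
  unfold baseCov
  linarith [vC]

omit [Fintype V] [IsStrictOrderedRing R] in
/-- **The leaf martingale**: for a leaf `v` at `z` with pendant edge `e` of weight `t = p e`,
`mtForm(v-instance) = (1 − t) · P(Ω) · baseCov + t · mtForm(z-instance)`, the `z`-instance being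
the graph with `e` pinned closed and `z` in the role of `v`. -/
theorem mtForm_leaf (hleaf : ∀ f, v ∈ ends f → f = e) (hends : ends e = s(v, z)) (he : p e ≠ 1)
    (hvz : v ≠ z) (ha₁ : a₁ ≠ v) (ha₂ : a₂ ≠ v) (hb : b ≠ v) (hy : y ≠ v) :
    mtForm ends a₁ a₂ b v y p =
      (1 - p e) * (prob (Function.update p e 0) (Ω ends a₁ a₂) *
        baseCov ends a₁ a₂ b y (Function.update p e 0)) +
      p e * mtForm ends a₁ a₂ b z y (Function.update p e 0) := by
  -- sure facts with `e` pinned closed: `v` is isolated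
  have iso : ∀ {ω : Config E}, ω ∈ sureSet (Function.update p e 0) → ∀ {x : V},
      Conn ends ω x v → x = v := by
    intro ω hω x h
    exact conn_eq_of_isolated hleaf (hω.2 e (by simp)) (conn_symm h)
  -- sure facts with `e` pinned open: `v` is what `z` is
  have dict : ∀ {ω : Config E}, ω ∈ sureSet (Function.update p e 1) → ∀ {a : V}, a ≠ v →
      (Conn ends ω a v ↔ Conn ends ω a z) := by
    intro ω hω a ha
    exact conn_v_iff_conn_z_of_mem_sureSet_update_one hleaf hends hvz hω ha
  /- ## world 0: the `U`-masses vanish, the classes -/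
  have z1 : prob (Function.update p e 0)
      (connEvent ends a₁ v ∩ connEvent ends a₁ b ∩ Ω ends a₁ a₂) = 0 :=
    prob_update_zero_eq_zero_of_subset_U hleaf ha₁ (fun ω hω => hω.1.1)
  have z2 : prob (Function.update p e 0) (connEvent ends a₁ v ∩ Ω ends a₁ a₂) = 0 :=
    prob_update_zero_eq_zero_of_subset_U hleaf ha₁ (fun ω hω => hω.1)
  have z3 : prob (Function.update p e 0) (connEvent ends a₁ v ∩ connEvent ends a₂ y ∩
      connEvent ends a₁ b ∩ Ω ends a₁ a₂) = 0 :=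
    prob_update_zero_eq_zero_of_subset_U hleaf ha₁ (fun ω hω => hω.1.1.1)
  have z4 : prob (Function.update p e 0)
      (connEvent ends a₁ v ∩ connEvent ends a₂ y ∩ Ω ends a₁ a₂) = 0 :=
    prob_update_zero_eq_zero_of_subset_U hleaf ha₁ (fun ω hω => hω.1.1)
  have e010 : prob (Function.update p e 0) (cls01 ends a₁ a₂ v y) =
      prob (Function.update p e 0) (connEvent ends a₁ y ∩ Ω ends a₁ a₂) := by
    apply prob_congr_sure; ext ω
    simp only [cls01, Set.mem_inter_iff, Set.mem_compl_iff, mem_connEvent, mem_S, mem_Ω]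
    constructor
    · rintro ⟨⟨⟨_, hy'⟩, ha, _⟩, hs⟩; exact ⟨⟨hy', fun h => ha (conn_symm h)⟩, hs⟩
    · rintro ⟨⟨hy', ha⟩, hs⟩
      exact ⟨⟨⟨fun h => ha₁ (iso hs h), hy'⟩, fun h => ha (conn_symm h), fun h => ha₂ (iso hs h)⟩,
        hs⟩
  have e01e0 : prob (Function.update p e 0) (cls01e ends a₁ a₂ b v y) =
      prob (Function.update p e 0) (connEvent ends a₁ b ∩ connEvent ends a₁ y ∩ Ω ends a₁ a₂) := by
    apply prob_congr_sure; ext ω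
    simp only [cls01e, Set.mem_inter_iff, Set.mem_compl_iff, Set.mem_union, mem_connEvent, mem_S,
      mem_Ω]
    constructor
    · rintro ⟨⟨⟨⟨_, hy'⟩, ha, _⟩, hbb⟩, hs⟩
      refine ⟨⟨⟨?_, hy'⟩, fun h => ha (conn_symm h)⟩, hs⟩
      rcases hbb with h | h
      · exact h
      · exact absurd (iso hs (conn_symm h)) hb
    · rintro ⟨⟨⟨hbb, hy'⟩, ha⟩, hs⟩
      exact ⟨⟨⟨⟨fun h => ha₁ (iso hs h), hy'⟩, fun h => ha (conn_symm h), fun h => ha₂ (iso hs h)⟩,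
        Or.inl hbb⟩, hs⟩
  /- ## world 1: the `v`-events are the `z`-events, whose masses are flip-invariant -/
  have hz1 : z ≠ v := fun h => hvz h.symm
  have fa₁ : ∀ x, x ≠ v → FlipInvAt p e (connEvent ends a₁ x) :=
    fun x hx => flipInvAt_connEvent hleaf hends ha₁ hx
  have fa₂ : ∀ x, x ≠ v → FlipInvAt p e (connEvent ends a₂ x) :=
    fun x hx => flipInvAt_connEvent hleaf hends ha₂ hx
  have fΩ : FlipInvAt p e (Ω ends a₁ a₂) :=
    flipInvAt_avoidAll hleaf hends ha₁ (by simp [ha₂])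
  have fSz : FlipInvAt p e (S ends a₁ a₂ z) :=
    flipInvAt_avoidAll hleaf hends ha₂ (by simp [ha₁, hz1])
  have fzb : FlipInvAt p e (connEvent ends z b) := flipInvAt_connEvent hleaf hends hz1 hb
  have f01 : FlipInvAt p e (cls01 ends a₁ a₂ z y) :=
    ((fa₁ z hz1).compl.inter (fa₁ y hy)).inter fSz
  have f01e : FlipInvAt p e (cls01e ends a₁ a₂ b z y) :=
    f01.inter ((fa₁ b hb).union fzb)
  have flip : ∀ {A : Set (Config E)}, FlipInvAt p e A →
      prob (Function.update p e 1) A = prob (Function.update p e 0) A :=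
    fun hA => prob_update_one_eq_update_zero_of_flipInvAt he hA
  -- a flip-invariant event has the same mass under `p` and under `p[e↦0]`
  have inv : ∀ {A : Set (Config E)}, FlipInvAt p e A →
      prob p A = prob (Function.update p e 0) A := by
    intro A hA
    rw [prob_eq_pin p A e, flip hA]; ring
  -- the dictionary, event by event (on the sure set of `e` pinned open)
  have d1 : prob (Function.update p e 1) (connEvent ends a₁ v ∩ connEvent ends a₁ b ∩ Ω ends a₁ a₂)
      = prob (Function.update p e 0) (connEvent ends a₁ z ∩ connEvent ends a₁ b ∩ Ω ends a₁ a₂) := by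
    rw [← flip (((fa₁ z hz1).inter (fa₁ b hb)).inter fΩ)]
    apply prob_congr_sure; ext ω
    simp only [Set.mem_inter_iff, mem_connEvent]
    constructor
    · rintro ⟨⟨⟨hu, hx⟩, hΩ⟩, hs⟩; exact ⟨⟨⟨(dict hs ha₁).1 hu, hx⟩, hΩ⟩, hs⟩
    · rintro ⟨⟨⟨hu, hx⟩, hΩ⟩, hs⟩; exact ⟨⟨⟨(dict hs ha₁).2 hu, hx⟩, hΩ⟩, hs⟩
  have d2 : prob (Function.update p e 1) (connEvent ends a₁ v ∩ Ω ends a₁ a₂) =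
      prob (Function.update p e 0) (connEvent ends a₁ z ∩ Ω ends a₁ a₂) := by
    rw [← flip ((fa₁ z hz1).inter fΩ)]
    apply prob_congr_sure; ext ω
    simp only [Set.mem_inter_iff, mem_connEvent]
    constructor
    · rintro ⟨⟨hu, hΩ⟩, hs⟩; exact ⟨⟨(dict hs ha₁).1 hu, hΩ⟩, hs⟩
    · rintro ⟨⟨hu, hΩ⟩, hs⟩; exact ⟨⟨(dict hs ha₁).2 hu, hΩ⟩, hs⟩
  have d3 : prob (Function.update p e 1) (connEvent ends a₁ v ∩ connEvent ends a₂ y ∩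
      connEvent ends a₁ b ∩ Ω ends a₁ a₂) =
      prob (Function.update p e 0) (connEvent ends a₁ z ∩ connEvent ends a₂ y ∩
        connEvent ends a₁ b ∩ Ω ends a₁ a₂) := by
    rw [← flip ((((fa₁ z hz1).inter (fa₂ y hy)).inter (fa₁ b hb)).inter fΩ)]
    apply prob_congr_sure; ext ω
    simp only [Set.mem_inter_iff, mem_connEvent]
    constructor
    · rintro ⟨⟨⟨⟨hu, hy'⟩, hx⟩, hΩ⟩, hs⟩; exact ⟨⟨⟨⟨(dict hs ha₁).1 hu, hy'⟩, hx⟩, hΩ⟩, hs⟩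
    · rintro ⟨⟨⟨⟨hu, hy'⟩, hx⟩, hΩ⟩, hs⟩; exact ⟨⟨⟨⟨(dict hs ha₁).2 hu, hy'⟩, hx⟩, hΩ⟩, hs⟩
  have d4 : prob (Function.update p e 1) (connEvent ends a₁ v ∩ connEvent ends a₂ y ∩ Ω ends a₁ a₂)
      = prob (Function.update p e 0) (connEvent ends a₁ z ∩ connEvent ends a₂ y ∩ Ω ends a₁ a₂) := by
    rw [← flip (((fa₁ z hz1).inter (fa₂ y hy)).inter fΩ)]
    apply prob_congr_sure; ext ω
    simp only [Set.mem_inter_iff, mem_connEvent]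
    constructor
    · rintro ⟨⟨⟨hu, hy'⟩, hΩ⟩, hs⟩; exact ⟨⟨⟨(dict hs ha₁).1 hu, hy'⟩, hΩ⟩, hs⟩
    · rintro ⟨⟨⟨hu, hy'⟩, hΩ⟩, hs⟩; exact ⟨⟨⟨(dict hs ha₁).2 hu, hy'⟩, hΩ⟩, hs⟩
  have d01 : prob (Function.update p e 1) (cls01 ends a₁ a₂ v y) =
      prob (Function.update p e 0) (cls01 ends a₁ a₂ z y) := by
    rw [← flip f01]
    apply prob_congr_sure; ext ω
    simp only [cls01, Set.mem_inter_iff, Set.mem_compl_iff, mem_connEvent, mem_S]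
    constructor
    · rintro ⟨⟨⟨hu, hy'⟩, ha, hv'⟩, hs⟩
      exact ⟨⟨⟨fun h => hu ((dict hs ha₁).2 h), hy'⟩, ha, fun h => hv' ((dict hs ha₂).2 h)⟩, hs⟩
    · rintro ⟨⟨⟨hu, hy'⟩, ha, hz'⟩, hs⟩
      exact ⟨⟨⟨fun h => hu ((dict hs ha₁).1 h), hy'⟩, ha, fun h => hz' ((dict hs ha₂).1 h)⟩, hs⟩
  have d01e : prob (Function.update p e 1) (cls01e ends a₁ a₂ b v y) =
      prob (Function.update p e 0) (cls01e ends a₁ a₂ b z y) := by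
    rw [← flip f01e]
    apply prob_congr_sure; ext ω
    simp only [cls01e, Set.mem_inter_iff, Set.mem_compl_iff, Set.mem_union, mem_connEvent, mem_S]
    constructor
    · rintro ⟨⟨⟨⟨hu, hy'⟩, ha, hv'⟩, hbb⟩, hs⟩
      refine ⟨⟨⟨⟨fun h => hu ((dict hs ha₁).2 h), hy'⟩, ha, fun h => hv' ((dict hs ha₂).2 h)⟩, ?_⟩,
        hs⟩
      rcases hbb with h | h
      · exact Or.inl h
      · exact Or.inr (conn_symm ((dict hs hb).1 (conn_symm h)))
    · rintro ⟨⟨⟨⟨hu, hy'⟩, ha, hz'⟩, hbb⟩, hs⟩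
      refine ⟨⟨⟨⟨fun h => hu ((dict hs ha₁).1 h), hy'⟩, ha, fun h => hz' ((dict hs ha₂).1 h)⟩, ?_⟩,
        hs⟩
      rcases hbb with h | h
      · exact Or.inl h
      · exact Or.inr (conn_symm ((dict hs hb).2 (conn_symm h)))
  /- ## the algebra: every `v`-mass is a `t`-mixture of its two worlds -/
  have e5 : connEvent ends a₁ z ∩ connEvent ends a₁ b ∩ Ω ends a₁ a₂ =
      connEvent ends a₁ b ∩ connEvent ends a₁ z ∩ Ω ends a₁ a₂ := by
    rw [Set.inter_comm (connEvent ends a₁ z)]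
  unfold mtForm baseCov
  rw [inv fΩ, inv ((fa₁ b hb).inter fΩ), inv ((fa₁ y hy).inter fΩ), inv ((fa₂ y hy).inter fΩ),
    prob_eq_pin p (cls01e ends a₁ a₂ b v y) e, prob_eq_pin p (cls01 ends a₁ a₂ v y) e,
    prob_eq_pin p (connEvent ends a₁ v ∩ connEvent ends a₂ y ∩ connEvent ends a₁ b ∩ Ω ends a₁ a₂) e,
    prob_eq_pin p (connEvent ends a₁ v ∩ connEvent ends a₂ y ∩ Ω ends a₁ a₂) e,
    prob_eq_pin p (connEvent ends a₁ v ∩ connEvent ends a₁ b ∩ Ω ends a₁ a₂) e,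
    prob_eq_pin p (connEvent ends a₁ v ∩ Ω ends a₁ a₂) e]
  rw [z1, z2, z3, z4, e010, e01e0, d1, d2, d3, d4, d01, d01e, e5]
  ring

/-- **`(K′-T)` is inherited along leaf attachments**: if the `z`-instance satisfies `(K′-T)`, so does
the instance with a leaf `v` at `z`, at every weight of the pendant edge. -/
theorem kprimeT_of_leaf (hp : IsProbVec p) (hleaf : ∀ f, v ∈ ends f → f = e)
    (hends : ends e = s(v, z)) (he : p e ≠ 1) (hvz : v ≠ z) (ha₁ : a₁ ≠ v) (ha₂ : a₂ ≠ v)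
    (hb : b ≠ v) (hy : y ≠ v) (H : KPrimeTHolds ends a₁ a₂ b z y (Function.update p e 0)) :
    KPrimeTHolds ends a₁ a₂ b v y p := by
  have hp0 : IsProbVec (Function.update p e 0) := hp.update e le_rfl zero_le_one
  unfold KPrimeTHolds at H ⊢
  rw [mtForm_leaf hleaf hends he hvz ha₁ ha₂ hb hy]
  have h1 : 0 ≤ prob (Function.update p e 0) (Ω ends a₁ a₂) := prob_nonneg hp0 _
  have h2 : 0 ≤ baseCov ends a₁ a₂ b y (Function.update p e 0) := baseCov_nonneg hp0
  have ht0 : 0 ≤ p e := hp.nonneg e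
  have ht1 : 0 ≤ 1 - p e := sub_nonneg.2 (hp.le_one e)
  exact add_nonneg (mul_nonneg ht1 (mul_nonneg h1 h2)) (mul_nonneg ht0 H)

end Leaf

end KPrime

end Summit.Ventures.PercRepro2
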